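import Literature.AlgebraicGeometry.Resolution.GeneralizedStabilityFiniteRank
import Literature.AlgebraicGeometry.Resolution.GeneralizedStabilityProofs
import Literature.AlgebraicGeometry.Resolution.ValuationConjugacyNormal
import Literature.AlgebraicGeometry.Resolution.FiniteRankOverPrimeField
import Mathlib.FieldTheory.Normal.Basic
import Mathlib.FieldTheory.SplittingField.IsSplittingField
import HarnessLib

/-!
# Descent tools for Kuhlmann 2010, Lemma 5.3 (reduction of (R2) to ground fields of finite rank)

Topic: `Literature/AlgebraicGeometry/Resolution` (valued function fields). PROVED tools for the
henselization-free proof of the named fact `Kuhlmann2010AlgClosedFiniteRankReduction`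
(`GeneralizedStabilityFiniteRank.lean`) = the proof of F.-V. Kuhlmann, *Elimination of
ramification I: The generalized stability theorem*, Trans. AMS 362 (2010) = arXiv:1003.5678,
**Lemma 5.3** ("To prove (R2), it suffices to prove (R3)"): given a finite extension
`L | K(t)`, descend it to `L₀ | k(t)` for a small algebraically closed `k ⊆ K`, and compare the
extensions of the valuation and their ramification upstairs and downstairs. The printed proof
does the comparison through henselizations (Thm. 2.14, Prop. 2.24); here the same inequality
`d(L | K(t)) ≤ d(L₀ | k(t))` is obtained extension by extension, the conjugacy of the extensions
of a valuation in the normal extension `L₀ | k(t)` (`exists_smul_eq_of_normal`,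
`ValuationConjugacyNormal.lean`) taking the place of the uniqueness of the extension to the
henselization.

## Content (everything PROVED)

* `IsDefectlessIn.of_tower` — if `(F, O)` is defectless in `N` and `F ⊆ L ⊆ N` then `(F, O)`
  is defectless in `L` (fundamental inequality fibrewise, as in Cor. 2.16).
* `exists_comap_eq_and_comap_eq` — **common extension with prescribed restriction to a normal
  subextension**: for `F₀ ⊆ F`, `F₀ ⊆ L₀ ⊆ L` with `L₀ | F₀` finite normal and every
  `F₀`-automorphism of `L₀` induced by an `F`-automorphism of `L`, valuation rings `O = F°`
  and `W₀ = L₀°` agreeing on `F₀` have a common extension to `L` (Chevalley + conjugacy,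
  Zariski–Samuel II, VI §7, Thm. 12, Cor. 3).
* `finite_overrings_of_isAlgebraic_closure` — Kuhlmann 2010, Cor. 2.7 in the form: a field
  algebraic over the subfield generated by a finite set has finite rank for every valuation
  (from `FiniteRankOverPrimeField.lean`).
* **Descent of a finite normal extension along a basis with small structure constants**
  (`§ Descent`): for `F₀ ⊆ F`, an `F`-basis `b` of `L` whose structure constants, unit
  coordinates, minimal polynomials and root coordinates lie in `F₀`, the field
  `L₀ = F₀(b) ⊆ L` consists of the elements with coordinates in `F₀`
  (`mem_adjoin_range_iff_repr_mem`), has `F₀`-basis `b` (`exists_basis_adjoin_range`,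
  `finrank_adjoin_range_eq`), every `F₀`-automorphism of `L₀` extends to an `F`-automorphism
  of `L` (`exists_algEquiv_extends`), and `L₀ | F₀` is normal when `L | F` is
  (`normal_adjoin_range`).
* Ramification comparison (`§ Ramification`): `ramificationIndex_comap_le_of_disjoint`
  (`e(W₀/F₀) ≤ e(W/F)` when `vL₀ ∩ vF ⊆ vF₀`, the local form of Kuhlmann's Prop. 2.24,
  "(v(L.F):vF) ≥ (vL+vF:vF) = (vL:vK)") and `inertiaDegree_eq_one_of_isAlgClosed_residueField`
  (`f = 1` over an algebraically closed residue field).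

## Sources

* F.-V. Kuhlmann, loc. cit., §2.4 (Lemma 2.19, Lemma 2.20, Prop. 2.24), §5 (Lemma 5.3),
  pp. 7–8, 18 of arXiv:1003.5678.
* O. Zariski, P. Samuel, *Commutative Algebra* II (1960), Ch. VI §7 (Thm. 12, Cor. 3), §11.
-/

noncomputable section

open IsLocalRing
open scoped Pointwise

namespace Literature.AlgebraicGeometry.Resolution

universe u

/-! ### Defectless in a tower -/

section Tower

variable {F L N : Type u} [Field F] [Field L] [Field N] [Algebra F L] [Algebra L N] [Algebra F N]
  [IsScalarTower F L N]

/-- **Defectless in a subextension**: if `L/F` and `N/L` are finite and `(F, F°)` is defectless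
in `N`, then it is defectless in `L` (grouping the extensions of `F°` to `N` by their
restrictions to `L`, the tower laws and the fundamental inequality give
`[N : F] = ∑_{O₁} e f(O₁/F) ∑_{O'' | O₁} e f(O''/L) ≤ (∑_{O₁} e f(O₁/F)) [N : L] ≤ [L : F][N : L]`,
so `∑_{O₁} e f(O₁/F) = [L : F]`). PROVED, as `IsDefectlessField.of_finiteDimensional`
(Kuhlmann 2010, Cor. 2.16). [cite: Kuhlmann2010, Cor. 2.16 (proof pattern)] -/
theorem IsDefectlessIn.of_tower [FiniteDimensional F L] [FiniteDimensional L N]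
    (O : ValuationSubring F) (h : IsDefectlessIn F O N) : IsDefectlessIn F O L := by
  classical
  haveI : FiniteDimensional F N := Module.Finite.trans L N
  obtain ⟨sN, hsN, hsumN⟩ := h
  obtain ⟨sL, hsL, hleL⟩ := FundamentalInequality_holds F L inferInstance O
  choose t ht hle using fun O₁ : ValuationSubring L => FundamentalInequality_holds L N inferInstance O₁
  have hKM : ∀ O'' : ValuationSubring N, O''.comap (algebraMap F N) =
      (O''.comap (algebraMap L N)).comap (algebraMap F L) := fun O'' => by
    rw [ValuationSubring.comap_comap, ← IsScalarTower.algebraMap_eq F L N]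
  have hmaps : ∀ O'' ∈ sN, O''.comap (algebraMap L N) ∈ sL := fun O'' hO'' => by
    rw [hsL, ← hKM]
    exact (hsN O'').mp hO''
  have hfib : ∀ O₁ ∈ sL,
      sN.filter (fun O'' => O''.comap (algebraMap L N) = O₁) = t O₁ := fun O₁ hO₁ => by
    ext O''
    rw [Finset.mem_filter, hsN, ht, hKM]
    constructor
    · exact fun h => h.2
    · intro hc
      exact ⟨by rw [hc]; exact (hsL O₁).mp hO₁, hc⟩
  have hkey : Module.finrank F N = ∑ O₁ ∈ sL, ramificationIndex F O₁ * inertiaDegree F O₁ *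
      ∑ O'' ∈ t O₁, ramificationIndex L O'' * inertiaDegree L O'' := by
    rw [← hsumN, ← Finset.sum_fiberwise_of_maps_to hmaps]
    refine Finset.sum_congr rfl fun O₁ hO₁ => ?_
    rw [hfib O₁ hO₁, Finset.mul_sum]
    refine Finset.sum_congr rfl fun O'' hO'' => ?_
    have hc : O''.comap (algebraMap L N) = O₁ := (ht O₁ O'').mp hO''
    rw [ramificationIndex_tower F L O'', inertiaDegree_tower F L O'', hc]
    ring
  have h1 : Module.finrank F N ≤
      (∑ O₁ ∈ sL, ramificationIndex F O₁ * inertiaDegree F O₁) * Module.finrank L N := by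
    rw [hkey, Finset.sum_mul]
    exact Finset.sum_le_sum fun O₁ _ => Nat.mul_le_mul_left _ (hle O₁)
  have hpos : 0 < Module.finrank L N := Module.finrank_pos
  refine ⟨sL, hsL, le_antisymm hleL ?_⟩
  rw [← Module.finrank_mul_finrank F L N] at h1
  exact Nat.le_of_mul_le_mul_right h1 hpos

end Tower

/-! ### Common extensions with prescribed restriction to a normal subextension -/

section Lift

variable {F₀ F L₀ L : Type u} [Field F₀] [Field F] [Field L₀] [Field L]
  [Algebra F₀ F] [Algebra F L] [Algebra F₀ L] [IsScalarTower F₀ F L]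
  [Algebra F₀ L₀] [Algebra L₀ L] [IsScalarTower F₀ L₀ L]

/-- **Common extension of two valuations with prescribed restriction to a normal
subextension.** Let `F₀ ⊆ F` and `F₀ ⊆ L₀ ⊆ L` be fields inside `L`, with `L₀/F₀` finite
normal and such that every `F₀`-automorphism of `L₀` is induced by an `F`-automorphism of `L`
(e.g. `L = F ⊗_{F₀} L₀`). If `O = F°` and `W₀ = L₀°` induce the same valuation ring on `F₀`,
then some valuation ring `W` of `L` satisfies `W ∩ F = O` and `W ∩ L₀ = W₀`. PROVED: extend
`O` to some `W'` (Chevalley, `exists_valuationSubring_comap_eq` of `SmoothUniformization.lean`),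
move `W' ∩ L₀` to `W₀` by a conjugation `τ` of `L₀/F₀`
(`exists_smul_eq_of_normal`, Zariski–Samuel II, VI §7, Thm. 12, Cor. 3), lift `τ` to `σ` and
take `W = σ(W')`. [cite: ZariskiSamuel1960, Ch. VI §7, Thm. 12, Cor. 3; §11 (p. 55)] -/
theorem exists_comap_eq_and_comap_eq [FiniteDimensional F₀ L₀] [Normal F₀ L₀]
    (hlift : ∀ τ : L₀ ≃ₐ[F₀] L₀, ∃ σ : L ≃ₐ[F] L,
      ∀ x : L₀, σ (algebraMap L₀ L x) = algebraMap L₀ L (τ x))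
    (O : ValuationSubring F) (W₀ : ValuationSubring L₀)
    (hW₀ : W₀.comap (algebraMap F₀ L₀) = O.comap (algebraMap F₀ F)) :
    ∃ W : ValuationSubring L,
      W.comap (algebraMap F L) = O ∧ W.comap (algebraMap L₀ L) = W₀ := by
  obtain ⟨W', hW'⟩ := exists_valuationSubring_comap_eq (Ω := L) O
  have h1 : (W'.comap (algebraMap L₀ L)).comap (algebraMap F₀ L₀) =
      W₀.comap (algebraMap F₀ L₀) := by
    rw [hW₀, ValuationSubring.comap_comap, ← IsScalarTower.algebraMap_eq F₀ L₀ L,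
      IsScalarTower.algebraMap_eq F₀ F L, ← ValuationSubring.comap_comap, hW']
  obtain ⟨τ, hτ⟩ := exists_smul_eq_of_normal F₀ _ _ h1
  obtain ⟨σ, hσ⟩ := hlift τ
  refine ⟨σ • W', ?_, ?_⟩
  · rw [comap_smul_algEquiv, hW']
  · rw [← hτ]
    ext y
    rw [ValuationSubring.mem_comap, ValuationSubring.mem_pointwise_smul_iff_inv_smul_mem,
      ValuationSubring.mem_pointwise_smul_iff_inv_smul_mem, ValuationSubring.mem_comap,
      AlgEquiv.smul_def, AlgEquiv.smul_def]
    have hστ : σ⁻¹ (algebraMap L₀ L y) = algebraMap L₀ L (τ⁻¹ y) := by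
      rw [AlgEquiv.aut_inv, AlgEquiv.aut_inv, AlgEquiv.symm_apply_eq, hσ,
        AlgEquiv.apply_symm_apply]
    rw [hστ]

end Lift

/-! ### Finite rank over a finitely generated subfield (Kuhlmann 2010, Cor. 2.7) -/

section FiniteRank

variable {Ω : Type u} [Field Ω]

/-- **Kuhlmann 2010, Cor. 2.7, relative to a finitely generated subfield**: if `Ω` is
algebraic over the subfield generated by a finite set `s`, then every valuation ring of `Ω`
has finitely many overrings ("Every valued field of finite transcendence degree over its
prime field has finite rank"; `finite_overrings_of_isAlgebraic_adjoin`,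
`FiniteRankOverPrimeField.lean`). PROVED. [cite: Kuhlmann2010, Cor. 2.7] -/
theorem finite_overrings_of_isAlgebraic_closure (V : ValuationSubring Ω) {s : Set Ω}
    (hs : s.Finite) (halg : ∀ x : Ω, IsAlgebraic (Subfield.closure s) x) :
    Finite {S : ValuationSubring Ω // V ≤ S} := by
  set E : IntermediateField (⊥ : Subfield Ω) Ω := IntermediateField.adjoin (⊥ : Subfield Ω) s
    with hE
  have hle : Subfield.closure s ≤ E.toSubfield :=
    Subfield.closure_le.mpr fun x hx => IntermediateField.subset_adjoin (⊥ : Subfield Ω) s hx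
  letI : Algebra (Subfield.closure s) E := (Subfield.inclusion hle).toAlgebra
  haveI : IsScalarTower (Subfield.closure s) E Ω := IsScalarTower.of_algebraMap_eq fun _ => rfl
  haveI : Algebra.IsAlgebraic (Subfield.closure s) Ω := ⟨halg⟩
  haveI : Algebra.IsAlgebraic E Ω := Algebra.IsAlgebraic.tower_top (K := Subfield.closure s) E
  exact finite_overrings_of_isAlgebraic_adjoin V hs

end FiniteRank

/-! ### Descent of a finite extension along a basis with small structure constants -/

section Descent

variable {F₀ F L : Type u} [Field F₀] [Field F] [Field L] [Algebra F₀ F] [Algebra F L]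
  [Algebra F₀ L] [IsScalarTower F₀ F L]
variable {ι : Type*} [Fintype ι] (b : Module.Basis ι F L)

omit [Fintype ι] in
/-- The coordinates of `c • x`, `c ∈ F₀`, are `c` times those of `x`. [folklore] -/
theorem repr_smul_of_tower (c : F₀) (x : L) (l : ι) :
    b.repr (c • x) l = algebraMap F₀ F c * b.repr x l := by
  rw [← algebraMap_smul F c x, map_smul, Finsupp.smul_apply, smul_eq_mul]

/-- Elements all of whose `b`-coordinates lie in `F₀` are `F₀`-combinations of the basis
vectors, hence lie in `F₀(b)`. [folklore] -/
theorem mem_adjoin_of_repr_mem {x : L} (hx : ∀ l, b.repr x l ∈ (algebraMap F₀ F).range) :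
    x ∈ IntermediateField.adjoin F₀ (Set.range b) := by
  rw [← b.sum_repr x]
  refine sum_mem fun l _ => ?_
  obtain ⟨c, hc⟩ := hx l
  rw [← hc, algebraMap_smul, Algebra.smul_def]
  exact mul_mem (algebraMap_mem _ c) (IntermediateField.subset_adjoin _ _ ⟨l, rfl⟩)

/-- The elements of `L` all of whose `b`-coordinates lie in `F₀` form an `F₀`-subalgebra, for a
basis `b` whose structure constants and unit coordinates lie in `F₀`. [folklore] -/
theorem exists_subalgebra_repr_mem (hmul : ∀ i j l, b.repr (b i * b j) l ∈ (algebraMap F₀ F).range)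
    (hone : ∀ l, b.repr 1 l ∈ (algebraMap F₀ F).range) :
    ∃ A : Subalgebra F₀ L, ∀ x : L, x ∈ A ↔ ∀ l, b.repr x l ∈ (algebraMap F₀ F).range := by
  classical
  refine ⟨{ carrier := {x | ∀ l, b.repr x l ∈ (algebraMap F₀ F).range}
            mul_mem' := ?_, one_mem' := hone, add_mem' := ?_, zero_mem' := ?_,
            algebraMap_mem' := ?_ }, fun x => Iff.rfl⟩
  · intro x y hx hy l
    have hxy : b.repr (x * y) l =
        ∑ i, ∑ j, b.repr x i * b.repr y j * b.repr (b i * b j) l := by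
      conv_lhs => rw [← b.sum_repr x, ← b.sum_repr y, Finset.sum_mul_sum]
      simp only [map_sum, Finsupp.coe_finsetSum, Finset.sum_apply]
      refine Finset.sum_congr rfl fun i _ => Finset.sum_congr rfl fun j _ => ?_
      rw [smul_mul_smul_comm, map_smul, Finsupp.smul_apply, smul_eq_mul]
    rw [hxy]
    exact sum_mem fun i _ => sum_mem fun j _ => mul_mem (mul_mem (hx i) (hy j)) (hmul i j l)
  · intro x y hx hy l
    rw [map_add, Finsupp.add_apply]
    exact add_mem (hx l) (hy l)
  · intro l
    rw [map_zero, Finsupp.zero_apply]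
    exact zero_mem _
  · intro c l
    rw [Algebra.algebraMap_eq_smul_one, repr_smul_of_tower]
    exact mul_mem ⟨c, rfl⟩ (hone l)

variable {b}
variable (hmul : ∀ i j l, b.repr (b i * b j) l ∈ (algebraMap F₀ F).range)
  (hone : ∀ l, b.repr 1 l ∈ (algebraMap F₀ F).range)
include hmul hone

/-- **`F₀(b)` is the set of elements with coordinates in `F₀`** (for `b` with structure
constants and unit coordinates in `F₀` and `bᵢ` algebraic over `F₀`): `F₀(b)` is then the
`F₀`-algebra generated by the `bᵢ`, contained in the subalgebra of `exists_subalgebra_repr_mem`.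
[folklore] -/
theorem mem_adjoin_range_iff_repr_mem (halg : ∀ i, IsAlgebraic F₀ (b i)) {x : L} :
    x ∈ IntermediateField.adjoin F₀ (Set.range b) ↔ ∀ l, b.repr x l ∈ (algebraMap F₀ F).range := by
  classical
  refine ⟨fun hx => ?_, mem_adjoin_of_repr_mem b⟩
  obtain ⟨A, hA⟩ := exists_subalgebra_repr_mem b hmul hone
  have hbA : ∀ i, b i ∈ A := fun i => (hA _).mpr fun l => by
    rw [b.repr_self, Finsupp.single_apply]
    split_ifs
    · exact one_mem _
    · exact zero_mem _
  have hle : (IntermediateField.adjoin F₀ (Set.range b)).toSubalgebra ≤ A := by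
    rw [IntermediateField.adjoin_toSubalgebra_of_isAlgebraic (by rintro _ ⟨i, rfl⟩; exact halg i)]
    exact Algebra.adjoin_le (by rintro _ ⟨i, rfl⟩; exact hbA i)
  exact (hA x).mp (hle hx)

/-- **The descended basis**: `b` is an `F₀`-basis of `F₀(b)`. [folklore] -/
theorem exists_basis_adjoin_range (halg : ∀ i, IsAlgebraic F₀ (b i)) :
    ∃ b₀ : Module.Basis ι F₀ (IntermediateField.adjoin F₀ (Set.range b)),
      ∀ l, ((b₀ l : IntermediateField.adjoin F₀ (Set.range b)) : L) = b l := by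
  refine ⟨Module.Basis.mk
    (v := fun l => ⟨b l, IntermediateField.subset_adjoin _ _ ⟨l, rfl⟩⟩) ?_ ?_, fun l => ?_⟩
  · haveI : FaithfulSMul F₀ F :=
      (faithfulSMul_iff_algebraMap_injective F₀ F).mpr (algebraMap F₀ F).injective
    have hb : LinearIndependent F₀ b := b.linearIndependent.restrict_scalars' F₀
    refine LinearIndependent.of_comp
      ((IntermediateField.adjoin F₀ (Set.range b)).val.toLinearMap) ?_
    exact hb
  · rintro x -
    choose c hc using (mem_adjoin_range_iff_repr_mem hmul hone halg).mp x.2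
    have hx : x = ∑ l, c l • (⟨b l, IntermediateField.subset_adjoin _ _ ⟨l, rfl⟩⟩ :
        IntermediateField.adjoin F₀ (Set.range b)) := by
      apply Subtype.ext
      rw [AddSubmonoidClass.coe_finsetSum]
      conv_lhs => rw [← b.sum_repr (x : L)]
      refine Finset.sum_congr rfl fun l _ => ?_
      rw [IntermediateField.coe_smul, ← hc l, algebraMap_smul]
    rw [hx]
    exact Submodule.sum_mem _ fun l _ => Submodule.smul_mem _ _ (Submodule.subset_span ⟨l, rfl⟩)
  · rw [Module.Basis.mk_apply]

/-- **`[F₀(b) : F₀] = [L : F]`**: both equal the number of basis vectors. [folklore] -/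
theorem finrank_adjoin_range_eq (halg : ∀ i, IsAlgebraic F₀ (b i)) :
    Module.finrank F₀ (IntermediateField.adjoin F₀ (Set.range b)) = Module.finrank F L := by
  obtain ⟨b₀, -⟩ := exists_basis_adjoin_range hmul hone halg
  rw [Module.finrank_eq_card_basis b₀, Module.finrank_eq_card_basis b]

/-- `F₀(b)` is finite over `F₀`. [folklore] -/
theorem finiteDimensional_adjoin_range (halg : ∀ i, IsAlgebraic F₀ (b i)) :
    FiniteDimensional F₀ (IntermediateField.adjoin F₀ (Set.range b)) := by
  obtain ⟨b₀, -⟩ := exists_basis_adjoin_range hmul hone halg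
  exact Module.Basis.finiteDimensional_of_finite b₀

/-- **Every `F₀`-automorphism of `F₀(b)` extends to an `F`-automorphism of `L`** (the
`F`-linear map `∑ aₗ bₗ ↦ ∑ aₗ τ(bₗ)` is multiplicative because the structure constants lie in
`F₀`; i.e. `L = F ⊗_{F₀} F₀(b)`). [folklore] -/
theorem exists_algEquiv_extends (halg : ∀ i, IsAlgebraic F₀ (b i))
    (τ : (IntermediateField.adjoin F₀ (Set.range b)) ≃ₐ[F₀]
      (IntermediateField.adjoin F₀ (Set.range b))) :
    ∃ σ : L ≃ₐ[F] L, ∀ x : IntermediateField.adjoin F₀ (Set.range b), σ x = τ x := by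
  classical
  let L₀ := IntermediateField.adjoin F₀ (Set.range b)
  obtain ⟨b₀, hb₀⟩ := exists_basis_adjoin_range hmul hone halg
  -- the `F`-linear extension of `τ`
  let f : L →ₗ[F] L := b.constr F fun l => ((τ (b₀ l) : L₀) : L)
  have hf : ∀ l, f (b l) = τ (b₀ l) := fun l => b.constr_basis F _ l
  -- `f` agrees with `τ` on `L₀`
  have hfτ : ∀ x : L₀, f x = τ x := by
    intro x
    have hx : (x : L) = ∑ l, b₀.repr x l • b l := by
      conv_lhs => rw [← b₀.sum_repr x]
      rw [AddSubmonoidClass.coe_finsetSum]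
      refine Finset.sum_congr rfl fun l _ => ?_
      rw [IntermediateField.coe_smul, hb₀]
    have h1 : f x = ∑ l, b₀.repr x l • f (b l) := by
      rw [hx, map_sum]
      refine Finset.sum_congr rfl fun l _ => ?_
      rw [LinearMap.map_smul_of_tower]
    rw [h1]
    conv_rhs => rw [← b₀.sum_repr x, map_sum, AddSubmonoidClass.coe_finsetSum]
    refine Finset.sum_congr rfl fun l _ => ?_
    rw [hf, map_smul, IntermediateField.coe_smul]
  -- `f` is multiplicative and unital
  have hmulb : ∀ i j, f (b i * b j) = f (b i) * f (b j) := by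
    intro i j
    have hij : b i * b j = ((b₀ i * b₀ j : L₀) : L) := by
      rw [MulMemClass.coe_mul, hb₀, hb₀]
    rw [hij, hfτ, map_mul, MulMemClass.coe_mul, ← hb₀ i, ← hb₀ j, hfτ, hfτ]
  have hfmul : ∀ x y, f (x * y) = f x * f y := by
    intro x y
    have key : (LinearMap.mul F L).compr₂ f = (LinearMap.mul F L ∘ₗ f).compl₂ f :=
      b.ext fun i => b.ext fun j => by
        simp only [LinearMap.compr₂_apply, LinearMap.mul_apply', LinearMap.compl₂_apply,
          LinearMap.comp_apply]
        exact hmulb i j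
    have := congrArg (fun g : L →ₗ[F] L →ₗ[F] L => g x y) key
    simpa only [LinearMap.compr₂_apply, LinearMap.mul_apply', LinearMap.compl₂_apply,
      LinearMap.comp_apply] using this
  have hfone : f 1 = 1 := by
    have h1 : (1 : L) = ((1 : L₀) : L) := rfl
    rw [h1, hfτ, map_one]
  let σₐ : L →ₐ[F] L := AlgHom.ofLinearMap f hfone hfmul
  have hinj : Function.Injective σₐ := σₐ.toRingHom.injective
  haveI : FiniteDimensional F L := Module.Basis.finiteDimensional_of_finite b
  have hbij : Function.Bijective σₐ :=
    ⟨hinj, LinearMap.surjective_of_injective (f := f) hinj⟩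
  refine ⟨AlgEquiv.ofBijective σₐ hbij, fun x => ?_⟩
  change f x = _
  exact hfτ x

/-- **`F₀(b) | F₀` is normal when `L | F` is**, provided the minimal polynomials of the `bᵢ`
over `F` and the coordinates of all their roots in `L` lie in `F₀`: then `F₀(b)` is a
splitting field over `F₀` of the product of the descended minimal polynomials. [folklore] -/
theorem normal_adjoin_range [Normal F L] (halg : ∀ i, IsAlgebraic F₀ (b i))
    (hmin : ∀ i, ∃ q : Polynomial F₀, q ≠ 0 ∧ q.map (algebraMap F₀ F) = minpoly F (b i))
    (hroots : ∀ i, ∀ x ∈ (minpoly F (b i)).rootSet L,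
      ∀ l, b.repr x l ∈ (algebraMap F₀ F).range) :
    Normal F₀ (IntermediateField.adjoin F₀ (Set.range b)) := by
  classical
  let L₀ := IntermediateField.adjoin F₀ (Set.range b)
  choose q hq0 hq using hmin
  let P : Polynomial F₀ := ∏ i, q i
  have hP0 : P ≠ 0 := Finset.prod_ne_zero_iff.mpr fun i _ => hq0 i
  haveI : FiniteDimensional F L := Module.Basis.finiteDimensional_of_finite b
  -- `P` splits in `L`
  have hPL : (P.map (algebraMap F₀ L)).Splits := by
    rw [Polynomial.map_prod]
    refine Polynomial.Splits.prod fun i _ => ?_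
    rw [IsScalarTower.algebraMap_eq F₀ F L, ← Polynomial.map_map, hq i]
    exact Normal.splits inferInstance (b i)
  -- its roots in `L` lie in `L₀`
  have hrootsL₀ : ∀ x ∈ P.rootSet L, x ∈ L₀ := by
    intro x hx
    rw [Polynomial.mem_rootSet] at hx
    obtain ⟨-, hx⟩ := hx
    rw [map_prod, Finset.prod_eq_zero_iff] at hx
    obtain ⟨i, -, hi⟩ := hx
    have hi' : Polynomial.aeval x (minpoly F (b i)) = 0 := by
      rw [← hq i, Polynomial.aeval_map_algebraMap]
      exact hi
    have hxr : x ∈ (minpoly F (b i)).rootSet L :=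
      Polynomial.mem_rootSet.mpr ⟨minpoly.ne_zero (IsIntegral.of_finite F (b i)), hi'⟩
    exact mem_adjoin_of_repr_mem b (hroots i x hxr)
  -- the basis vectors are roots of `P`
  obtain ⟨b₀, hb₀⟩ := exists_basis_adjoin_range hmul hone halg
  have hb₀root : ∀ l, b₀ l ∈ P.rootSet L₀ := by
    intro l
    rw [Polynomial.mem_rootSet]
    refine ⟨hP0, ?_⟩
    apply Subtype.ext
    have h := Polynomial.aeval_algHom_apply L₀.val (b₀ l) P
    change Polynomial.aeval (b₀ l : L) P = (L₀.val (Polynomial.aeval (b₀ l) P) : L) at h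
    change ((Polynomial.aeval (b₀ l) P : L₀) : L) = 0
    rw [show ((Polynomial.aeval (b₀ l) P : L₀) : L) = L₀.val (Polynomial.aeval (b₀ l) P) from rfl,
      ← h, hb₀, map_prod, Finset.prod_eq_zero_iff]
    refine ⟨l, Finset.mem_univ _, ?_⟩
    rw [← Polynomial.aeval_map_algebraMap F, hq l]
    exact minpoly.aeval F (b l)
  haveI : Polynomial.IsSplittingField F₀ L₀ P := by
    refine ⟨IntermediateField.splits_of_splits hPL hrootsL₀, ?_⟩
    have halg₀ : ∀ x ∈ Set.range b₀, IsAlgebraic F₀ x := by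
      rintro _ ⟨l, rfl⟩
      rw [IntermediateField.isAlgebraic_iff, hb₀]
      exact halg l
    have h1 : IntermediateField.adjoin F₀ (Set.range b₀) = ⊤ := by
      apply IntermediateField.lift_injective L₀
      rw [IntermediateField.lift_adjoin, IntermediateField.lift_top]
      congr 1
      ext x
      constructor
      · rintro ⟨_, ⟨l, rfl⟩, rfl⟩
        exact ⟨l, (hb₀ l).symm⟩
      · rintro ⟨l, rfl⟩
        exact ⟨b₀ l, ⟨l, rfl⟩, hb₀ l⟩
    have h2 := IntermediateField.adjoin_toSubalgebra_of_isAlgebraic halg₀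
    rw [h1, IntermediateField.top_toSubalgebra] at h2
    rw [eq_top_iff, h2]
    exact Algebra.adjoin_mono (by rintro _ ⟨l, rfl⟩; exact hb₀root l)
  exact Normal.of_isSplittingField P

end Descent

/-! ### Ramification and inertia under descent -/

section Ramification

variable {F₀ F L₀ L : Type u} [Field F₀] [Field F] [Field L₀] [Field L]
  [Algebra F₀ F] [Algebra F L] [Algebra F₀ L] [IsScalarTower F₀ F L]
  [Algebra F₀ L₀] [Algebra L₀ L] [IsScalarTower F₀ L₀ L]

/-- **`e(W ∩ L₀ / F₀) ≤ e(W / F)` when the value groups of `L₀` and `F` meet inside that of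
`F₀`** (the local form of Kuhlmann 2010, Prop. 2.24, first line of (9):
"`(v(L.F):vF) ≥ (vL+vF:vF) = (vL:vK)`", under the disjointness `vL ∩ vF = vK` of
Lemma 2.19 (1)): the injection `|L₀^×| → |L^×|` pulls `|F^×|` back to `|F₀^×|`, so
`[|L₀^×| : |F₀^×|]` is the index of `|F^×|` in a subgroup of `|L^×|`, which divides
`[|L^×| : |F^×|]`. PROVED. [cite: Kuhlmann2010, Prop. 2.24 with Lemma 2.19] -/
theorem ramificationIndex_comap_le_of_disjoint [FiniteDimensional F L] (W : ValuationSubring L)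
    (hdisj : ∀ (c : F) (y : L₀), c ≠ 0 →
      W.valuation (algebraMap L₀ L y) = W.valuation (algebraMap F L c) →
      ∃ c₀ : F₀, W.valuation (algebraMap F₀ L c₀) = W.valuation (algebraMap F L c)) :
    ramificationIndex F₀ (W.comap (algebraMap L₀ L)) ≤ ramificationIndex F W := by
  set W₀ := W.comap (algebraMap L₀ L) with hW₀
  let φ := unitsValueGroupHom L₀ W
  have hφ : ∀ γ : (ValuationSubring.ValueGroup W₀)ˣ,
      ((φ γ : (ValuationSubring.ValueGroup W)ˣ) : ValuationSubring.ValueGroup W) =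
        valueGroupHom L₀ W (γ : ValuationSubring.ValueGroup W₀) := fun _ => rfl
  have hcomap : (valueSubgroup F W).comap φ = valueSubgroup F₀ W₀ := by
    ext γ
    rw [Subgroup.mem_comap, mem_valueSubgroup_iff, mem_valueSubgroup_iff]
    obtain ⟨y, hy⟩ := W₀.valuation_surjective (γ : ValuationSubring.ValueGroup W₀)
    have hy0 : y ≠ 0 := by
      rintro rfl
      rw [map_zero] at hy
      exact γ.ne_zero hy.symm
    have hφγ : ((φ γ : (ValuationSubring.ValueGroup W)ˣ) : ValuationSubring.ValueGroup W) =
        W.valuation (algebraMap L₀ L y) := by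
      rw [hφ, ← hy, valueGroupHom_valuation]
    constructor
    · rintro ⟨c, hc0, hc⟩
      rw [hφγ] at hc
      obtain ⟨c₀, hc₀⟩ := hdisj c y hc0 hc
      have hc₀0 : c₀ ≠ 0 := by
        rintro rfl
        rw [map_zero, map_zero] at hc₀
        exact (map_ne_zero W.valuation).mpr ((map_ne_zero _).mpr hc0) hc₀.symm
      refine ⟨c₀, hc₀0, ?_⟩
      apply valueGroupHom_injective L₀ W
      rw [← hy, valueGroupHom_valuation, valueGroupHom_valuation, hc, ← hc₀,
        IsScalarTower.algebraMap_apply F₀ L₀ L]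
    · rintro ⟨c₀, hc₀0, hc₀⟩
      refine ⟨algebraMap F₀ F c₀, (map_ne_zero _).mpr hc₀0, ?_⟩
      rw [hφ, hc₀, valueGroupHom_valuation, ← IsScalarTower.algebraMap_apply,
        ← IsScalarTower.algebraMap_apply]
  unfold ramificationIndex
  rw [← hcomap, Subgroup.index_comap]
  obtain ⟨hfi, -, -⟩ := ramificationIndex_mul_inertiaDegree_le_finrank F W
  haveI := hfi
  exact Nat.le_of_dvd (Nat.pos_of_ne_zero Subgroup.FiniteIndex.index_ne_zero)
    (Subgroup.relIndex_dvd_index_of_normal _ _)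

/-- **`f = 1` over an algebraically closed residue field**: for `L₀ | F₀` finite and a
valuation ring `W₀ = L₀°` whose restriction to `F₀` has algebraically closed residue field,
the inertia degree `[L₀w : F₀v]` is `1` (Kuhlmann 2010, Lemma 2.1 / §2.4: `K̄` algebraically
closed for `K` algebraically closed, so `[L̄ : K̄] = 1` for finite `L̄ | K̄`). PROVED. [folklore] -/
theorem inertiaDegree_eq_one_of_isAlgClosed_residueField {F₀ L₀ : Type u} [Field F₀] [Field L₀]
    [Algebra F₀ L₀] [FiniteDimensional F₀ L₀] (W₀ : ValuationSubring L₀)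
    [IsAlgClosed (ResidueField (W₀.comap (algebraMap F₀ L₀)))] :
    inertiaDegree F₀ W₀ = 1 := by
  obtain ⟨-, hfin, -⟩ := ramificationIndex_mul_inertiaDegree_le_finrank F₀ W₀
  haveI := hfin
  have h1 : IsAlgClosed (residueFieldHom F₀ W₀).fieldRange :=
    IsAlgClosed.of_ringEquiv _ _ (RingEquiv.ofBijective (residueFieldHom F₀ W₀).rangeRestrictField
      (residueFieldHom F₀ W₀).rangeRestrictField_bijective)
  rw [fieldRange_residueFieldHom] at h1
  haveI := h1
  haveI : Algebra.IsIntegral (residueSubfield F₀ W₀) (ResidueField W₀) :=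
    Algebra.IsIntegral.of_finite _ _
  have hsurj := (IsAlgClosed.algebraMap_bijective_of_isIntegral
    (k := residueSubfield F₀ W₀) (K := ResidueField W₀)).2
  have htop : residueSubfield F₀ W₀ = ⊤ := eq_top_iff.mpr fun r _ => by
    obtain ⟨a, rfl⟩ := hsurj r
    exact a.2
  unfold inertiaDegree
  rw [htop]
  have h := Algebra.finrank_eq_of_equiv_equiv
    (Subfield.topEquiv : (⊤ : Subfield (ResidueField W₀)) ≃+* ResidueField W₀)
    (RingEquiv.refl (ResidueField W₀)) (by ext; rfl)
  rw [h, Module.finrank_self]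

end Ramification

end Literature.AlgebraicGeometry.Resolution
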